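import Mathlib
import Literature.NumberTheory.LFunctions.Zhang2022.TypedSection17
import Literature.NumberTheory.LFunctions.Zhang2022.TypedSection15A
import Literature.NumberTheory.LFunctions.Zhang2022.TypedSection16A
import Literature.NumberTheory.LFunctions.Zhang2022.TypedAppendixB
import Literature.NumberTheory.LFunctions.Zhang2022.TypedSection13Edges
import HarnessLib

/-!
# Zhang (2022), typed §17 — companion: the exact-identity leaves §17.u004, u008, u014, u016, u017(≤), u022
# DISCHARGED, and the merge bridges to §§15–16 / Appendix B

Topic `Literature/NumberTheory/LFunctions/Zhang2022` (Landau–Siegel audit tree; verdict-neutral).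
Y. Zhang, *Discrete mean estimates and the Landau–Siegel zero*, arXiv:2211.02515v1 (2022)
[Zhang2022LandauSiegel], §17 pp. 96–98 (tex L4719, L4746, L4793, L4829) — **an unrefereed
manuscript under adjudication; nothing here asserts or denies its Theorems 1–2.** Theorem-only
companion of `TypedSection17.lean` (campaign D-0069, layer L4, seat L4-t6; L4-lead RULINGS 6 (c),
2026-08-25): the DAG nodes of §17 that are EXACT IDENTITIES — Dirichlet-series bookkeeping, no
analysis — are proved in the kernel, so that the discharge lane (sz-d58's `eq17_5_of`, the chain
(17.3) ⇐ u004/u005, (17.8) ⇐ u014–u018) consumes them as theorems rather than hypotheses: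

* `step17_u004_holds : Step17_u004 c' χ` — "for `σ > 1`,
  `(L(s+β₁,ψ)/L(s,ψ))B(s,ψ)G(s,ψ)N(s+β₂,ψ)N(s+β₃,ψ) = Σ_m ν*(m)ψ(m)m^{−s}`" (§17.u004) with the typed
  `ν* = κ₂ ∗ (bχ) ∗ υ·[≤D⁴] ∗ nN β₂ ∗ nN β₃`: from Mathlib's `DirichletCharacter.LFunction_eq_LSeries`,
  `DirichletCharacter.LSeries.mul_mu_eq_one` (`L(s,ψ)⁻¹ = Σ μ(n)ψ(n)n^{−s}`) and `LSeries_convolution'`,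
  the shift `L(s+β₁,ψ) = Σ n^{−β₁}ψ(n)n^{−s}`, and the finite factors as `L`-series —
  in particular **`Bpoly_eq_LSeries : B(s,ψ) = Σ_n b(n)ψχ(n)n^{−s}`**, i.e. display (15.1) for the
  skeleton's `bcoef`, kernel-checked here (all `s`);
* `step17_u008_holds : Step17_u008 χ` — "`1∗μ∗χ∗χ∗υ∗1∗1 = ν`" (§17.u008): in the commutative ring
  `ArithmeticFunction ℂ`, `(ζμ)(χ·μχ)(μζ)(χζ) = χζ = ν` (`toArithmeticFunction_chi_mul_moebiusChi`:
  `χ ∗ μχ = δ`);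
* `step17_u014_holds : Step17_u014 c' χ` — "`G(s,ψ)N(s+β₂,ψ)N(s+β₃,ψ) = Σ_l ν₁*(l)ψ(l)l^{−s}`"
  (§17.u014), all `s` (finite Dirichlet polynomials);
* `step17_u022_holds : Step17_u022 c'` — "if `m₁` is square-free then `κ̄₂(m₁) = μ(m₁)ϱ₁(m₁)`"
  (§17.u022): `conj κ₂(m) = Σ_{m=ab} a^{β₁}μ(b)` and `μ(m/a) = μ(m)μ(a)` for `a ∣ m`, `m` square-free;
* `step17_u016_holds : Step17_u016 c'` — "for `σ < 0`, `L(1−s−β₁,ψ̄)/L(1−s,ψ̄) = Σ_m κ̄₂(m)ψ̄(m)m^{−(1−s)}`"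
  (§17.u016), from the general twisted ratio identity `LFunction_ratio_eq_LSeries_kappa₂`
  (`L(s+ib,θ)/L(s,θ) = Σ κ₂^{(b)}(n)θ(n)n^{−s}`, `Re s > 1`) at `θ = ψ⁻¹`, `b = −b₁`, and
  `kappa2bar_eq_kappa₂_neg` (`κ̄₂ = κ₂^{(−b₁)}`);
* `step17_u017_le_holds` — §17.u017 in the `l ≤ D⁴` READING: `(L(1−s−β₁,ψ̄)/L(1−s,ψ̄))F(1−s,ψ̄) =
  Σ_n ((ν·[≤D⁴]) ∗ κ̄₂)(n)ψ̄(n)n^{−(1−s)}`; the typed node `Step17_u017` carries the PRINTED `l < D⁴`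
  (`varrho17`), which differs by the boundary term `l = D⁴` (`ν(D⁴) = 1`) from what the skeleton's
  `F(1−s,ψ̄) = Σ_{n≤D⁴}` gives — recorded, not repaired (typed file, flag (i)).

Design. `β₁ ∈ iℝ` is the landed `Typed.Section13.beta1_re` (imported, not restated). `ψ`-twists commute with Dirichlet convolution for the completely multiplicative `ψ`, `ψχ`
(`convolution_mul_of_map_mul`); finitely supported sequences have everywhere-summable `L`-series
(`LSeriesSummable_of_support_le`); a finite Dirichlet polynomial whose coefficient vanishes off its
range is the `L`-series of its coefficient (`finsum_eq_LSeries`); `bcoef_eq_conv` records that the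
skeleton's `bcoef` is literally the convolution `(ϰ₁·[<P^{1/2}] + ι₂ϰ₂) ∗ (ῑ₃ϰ₃ + ῑ₄ϰ₂)` (`rfl`).
Theorems only: no definition, no claim node, no named fact. The analytic displays of §17 remain
CLAIM nodes of `TypedSection17.lean`.

MERGE of the sibling slices' objects (L4 RE-POINT (2); revision 2 of this companion): the three
TODO-merge stubs of `TypedSection17.lean` — `tg3` (§15 u016), `tg2` (§16 u009), `varrhoB` (App. B
§B.u001) — are BRIDGED here by `rfl` to the owners' landed declarations `Typed.Section15A.gtilde3`,
`Typed.Section16A.gTilde16`, `Typed.AppendixB.varrhoJ` (`tg3_eq`, `tg2_eq`, `varrhoB_eq`). The bridges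
live in this leaf file rather than in `TypedSection17.lean` so that the referee-frozen typed file
(tier-1 audit by sha) is not revised and does not inherit the sibling files' revision churn through
its imports; the logical content (one source of truth, kernel-checked) is the same.

## References

* Y. Zhang, arXiv:2211.02515v1 (2022), §17 p. 96 (u004, u008), p. 97 (u014), p. 98 (u022); §3 p. 12
  (`ν = 1∗χ`, `υ = μ∗μχ`, `F`, `G`); §6 p. 30 (`N`, `g*`); §12 (12.2), §15 (15.1) (`B`, `b`); §16 p. 89
  (`κ₂`); Appendix B p. 106 (`ϱ_j`). [cite: Zhang2022LandauSiegel, §17]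
-/

noncomputable section

open Complex Real ComplexConjugate
open scoped LSeries.notation

namespace Literature.NumberTheory.LFunctions.Zhang2022.Typed.Section17

open Literature.NumberTheory.LFunctions.Zhang2022
open Literature.NumberTheory.LFunctions.Zhang2022.Skeleton

/-! ## §17.u008 and §17.u022 -/

section DischargesA

variable {D : ℕ} (χ : DirichletCharacter ℂ D)

/-- The constant sequence `1` (value at `0` discarded) is the arithmetic function `ζ`. [folklore] -/
private theorem toArithmeticFunction_one :
    toArithmeticFunction (fun _ : ℕ => (1 : ℂ)) = (ArithmeticFunction.zeta : ArithmeticFunction ℂ) := by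
  ext n
  by_cases h : n = 0
  · simp [toArithmeticFunction, h]
  · simp [toArithmeticFunction, h, ArithmeticFunction.natCoe_apply, ArithmeticFunction.zeta_apply]

/-- The sequence `n ↦ μ(n)` (cast to `ℂ`) is the arithmetic function `↑μ`. [folklore] -/
private theorem toArithmeticFunction_moebius :
    toArithmeticFunction (fun k : ℕ => (ArithmeticFunction.moebius k : ℂ)) =
      (ArithmeticFunction.moebius : ArithmeticFunction ℂ) := by
  ext n
  by_cases h : n = 0
  · simp [toArithmeticFunction, h]
  · simp [toArithmeticFunction, h, ArithmeticFunction.intCoe_apply]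

/-- **`χ ∗ μχ = δ`**: a Dirichlet character (completely multiplicative on `ℕ`) convolved with its
Möbius twist is the Dirichlet unit — the identity behind "`L(s,χ)⁻¹ = Σ μ(n)χ(n)n^{−s}`" (§3 p. 12,
`υ = μ∗μχ`). [cite: Zhang2022LandauSiegel, §3 p.12] -/
theorem toArithmeticFunction_chi_mul_moebiusChi :
    toArithmeticFunction (fun k : ℕ => χ (k : ZMod D)) *
      toArithmeticFunction (fun k : ℕ => (ArithmeticFunction.moebius k : ℂ) * χ (k : ZMod D)) = 1 := by
  have h := LSeries.convolution_def (fun k : ℕ => χ (k : ZMod D))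
    (fun k : ℕ => (ArithmeticFunction.moebius k : ℂ) * χ (k : ZMod D))
  simp only [LSeries.convolution] at h
  apply ArithmeticFunction.coe_inj.mp
  rw [h]
  ext n
  rw [ArithmeticFunction.one_apply]
  have key : ∀ p ∈ n.divisorsAntidiagonal,
      χ (p.1 : ZMod D) * ((ArithmeticFunction.moebius p.2 : ℂ) * χ (p.2 : ZMod D)) =
        χ (n : ZMod D) * (ArithmeticFunction.moebius p.2 : ℂ) := by
    intro p hp
    have hpn : p.1 * p.2 = n := (Nat.mem_divisorsAntidiagonal.mp hp).1
    rw [← hpn, Nat.cast_mul, map_mul]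
    ring
  rw [Finset.sum_congr rfl key, ← Finset.mul_sum,
    Nat.sum_divisorsAntidiagonal' (f := fun _ b => (ArithmeticFunction.moebius b : ℂ))]
  have hμ : ∑ i ∈ n.divisors, (ArithmeticFunction.moebius i : ℂ) =
      ((ArithmeticFunction.moebius * ArithmeticFunction.zeta : ArithmeticFunction ℂ) n) := by
    rw [ArithmeticFunction.coe_mul_zeta_apply]
    simp [ArithmeticFunction.intCoe_apply]
  rw [hμ, ArithmeticFunction.coe_moebius_mul_coe_zeta, ArithmeticFunction.one_apply]
  split_ifs with h1
  · subst h1; simp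
  · simp

/-- **§17.u008 DISCHARGED** (§17 p. 96): "`1∗μ∗χ∗χ∗υ∗1∗1 = ν`" holds at every `n ≥ 1` (`υ = μ∗μχ`,
`ν = 1∗χ`): `(ζμ)(χ·μχ)(μζ)(χζ) = χζ = ν` in the commutative ring of arithmetic functions.
DAG `Z22:§17.u008` [Z22 p.96, tex L4746]. [cite: Zhang2022LandauSiegel, §17 u008 p.96] -/
theorem step17_u008_holds : Step17_u008 χ := by
  intro n hn
  set Z : ArithmeticFunction ℂ := toArithmeticFunction (fun _ : ℕ => (1 : ℂ)) with hZdef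
  set M : ArithmeticFunction ℂ :=
    toArithmeticFunction (fun k : ℕ => (ArithmeticFunction.moebius k : ℂ)) with hMdef
  set X : ArithmeticFunction ℂ := toArithmeticFunction (fun k : ℕ => χ (k : ZMod D)) with hXdef
  set MX : ArithmeticFunction ℂ :=
    toArithmeticFunction (fun k : ℕ => (ArithmeticFunction.moebius k : ℂ) * χ (k : ZMod D))
    with hMXdef
  have hZM : Z * M = 1 := by
    rw [hZdef, hMdef, toArithmeticFunction_one, toArithmeticFunction_moebius]
    exact ArithmeticFunction.coe_zeta_mul_coe_moebius
  have hXMX : X * MX = 1 := by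
    rw [hXdef, hMXdef]; exact toArithmeticFunction_chi_mul_moebiusChi χ
  simp only [LSeries.convolution, ups, ArithmeticFunction.toArithmeticFunction_eq_self]
  change (Z * M * X * X * (M * MX) * Z * Z) n = nu χ n
  have hprod : Z * M * X * X * (M * MX) * Z * Z = (Z * M) * (X * MX) * (Z * M) * (X * Z) := by ring
  rw [hprod, hZM, hXMX, one_mul, one_mul, one_mul, hZdef, toArithmeticFunction_one,
    ArithmeticFunction.coe_mul_zeta_apply, nu,
    Literature.NumberTheory.LFunctions.divisorSumChar_apply]
  refine Finset.sum_congr rfl fun d hd => ?_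
  have hd0 : d ≠ 0 := Nat.pos_iff_ne_zero.mp (Nat.pos_of_mem_divisors hd)
  simp [hXdef, toArithmeticFunction, hd0]

/-- `Step17_u008` — `_holds` alias of `step17_u008_holds` above under the fact's exact name (appended
2026-08-28, D-0026 bookkeeping: the proof term is the existing theorem of this file; no statement,
definition or attribute is edited; no new named fact; the ledger's debt table listed the fact
unproved). [cite: Zhang2022LandauSiegel, §17 u008 p.96] -/
theorem _root_.Literature.NumberTheory.LFunctions.Zhang2022.Typed.Section17.Step17_u008_holds :
    Step17_u008 χ :=
  _root_.Literature.NumberTheory.LFunctions.Zhang2022.Typed.Section17.step17_u008_holds (χ := χ)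

/-- `β₁ = i·b₁`: the skeleton's `beta1` against the real shift size `b1` (2.13).
[cite: Zhang2022LandauSiegel, §2 (2.13) p.5] -/
private theorem beta1_eq_b1I (c' : ℝ) (D : ℕ) : beta1 c' D = (b1 c' D : ℂ) * I := by
  simp only [beta1, b1]; push_cast; ring

/-- `β_j` at `j = 1` is `β₁` (the §8 index convention of `Skeleton.betaJ`).
[cite: Zhang2022LandauSiegel, §8 p.44] -/
private theorem betaJ_one (c' : ℝ) (D : ℕ) : betaJ c' D 1 = beta1 c' D := by
  simp [betaJ]

/-- `conj (n^{−ib}) = n^{ib}` for a natural number `n` and real `b`. [folklore] -/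
private theorem conj_natCast_cpow_negI (b : ℝ) (n : ℕ) :
    conj ((n : ℂ) ^ (-(b * I))) = (n : ℂ) ^ ((b : ℂ) * I) := by
  have harg : (n : ℂ).arg ≠ π := by rw [Complex.natCast_arg]; exact Real.pi_pos.ne
  have h := Complex.conj_cpow (n : ℂ) ((b : ℂ) * I) harg
  rw [Complex.conj_natCast] at h
  rw [h]
  congr 2
  simp [Complex.conj_ofReal]

/-- For square-free `m` and `a ∣ m`: `μ(m/a) = μ(m)μ(a)` (`a` and `m/a` are coprime, `μ(a)² = 1`).
[folklore] -/
private theorem moebius_div_of_squarefree {m a : ℕ} (hm : Squarefree m) (ha : a ∣ m) :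
    (ArithmeticFunction.moebius (m / a) : ℤ) =
      ArithmeticFunction.moebius m * ArithmeticFunction.moebius a := by
  obtain ⟨b, rfl⟩ := ha
  have ha0 : a ≠ 0 := by rintro rfl; simp at hm
  rw [Nat.mul_div_cancel_left b (Nat.pos_of_ne_zero ha0)]
  have hcop : a.Coprime b := (Nat.squarefree_mul_iff.mp hm).1
  have hsqa : Squarefree a := (Nat.squarefree_mul_iff.mp hm).2.1
  rw [ArithmeticFunction.isMultiplicative_moebius.map_mul_of_coprime hcop]
  have hsq : ArithmeticFunction.moebius a * ArithmeticFunction.moebius a = 1 := by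
    rw [← sq]; exact ArithmeticFunction.moebius_sq_eq_one_of_squarefree hsqa
  calc ArithmeticFunction.moebius b
      = ArithmeticFunction.moebius a * ArithmeticFunction.moebius a *
          ArithmeticFunction.moebius b := by rw [hsq, one_mul]
    _ = ArithmeticFunction.moebius a * ArithmeticFunction.moebius b *
          ArithmeticFunction.moebius a := by ring

/-- **§17.u022 DISCHARGED** (§17 p. 98): "If `m₁` is square-free, then `κ̄₂(m₁) = μ(m₁)ϱ₁(m₁)`" —
`conj κ₂(m) = Σ_{m=ab} a^{β₁}μ(b)` (`κ₂ = n^{−β₁}∗μ`, `β₁ ∈ iℝ`) and, for `m` square-free,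
`μ(m/a) = μ(m)μ(a)`, so the sum is `μ(m)Σ_{a∣m}μ(a)a^{β₁} = μ(m)ϱ₁(m)`. DAG `Z22:§17.u022`
[Z22 p.98, tex L4829]. [cite: Zhang2022LandauSiegel, §17 u022 p.98] -/
theorem step17_u022_holds (c' : ℝ) (D : ℕ) : Step17_u022 c' (D := D) := by
  intro m hm
  rw [kappa2bar, MeanSquareMajorant.kappa₂, ArithmeticFunction.mul_apply, map_sum, varrhoB, betaJ_one,
    beta1_eq_b1I, Finset.mul_sum]
  rw [Nat.sum_divisorsAntidiagonal (f := fun a b =>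
    conj (MeanSquareMajorant.powI (b1 c' D) a * ((ArithmeticFunction.moebius : ArithmeticFunction ℂ) b)))]
  refine Finset.sum_congr rfl fun a ha => ?_
  have ha0 : a ≠ 0 := Nat.pos_iff_ne_zero.mp (Nat.pos_of_mem_divisors ha)
  have hadvd : a ∣ m := Nat.dvd_of_mem_divisors ha
  rw [map_mul, MeanSquareMajorant.powI_apply_of_ne_zero _ ha0, conj_natCast_cpow_negI,
    ArithmeticFunction.intCoe_apply, map_intCast, moebius_div_of_squarefree hm hadvd]
  push_cast
  ring

end DischargesA

/-! ## §17.u004 and §17.u014: the Dirichlet-series identities -/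

section DischargesB
variable {D : ℕ} (x : Chr D)

/-- Twisting by a completely multiplicative `t` commutes with Dirichlet convolution. [folklore] -/
private theorem convolution_mul_of_map_mul (t : ℕ → ℂ) (ht : ∀ a b : ℕ, t (a * b) = t a * t b)
    (f g : ℕ → ℂ) :
    (fun n => f n * t n) ⍟ (fun n => g n * t n) = fun n => (f ⍟ g) n * t n := by
  rw [LSeries.convolution_def, LSeries.convolution_def]
  ext n
  rw [Finset.sum_mul]
  refine Finset.sum_congr rfl fun p hp => ?_
  have hpn : p.1 * p.2 = n := (Nat.mem_divisorsAntidiagonal.mp hp).1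
  rw [← hpn, ht]
  ring

/-- `ψ` is completely multiplicative on `ℕ`. [folklore] -/
private theorem psiFn_mul (a b : ℕ) : psiFn x (a * b) = psiFn x a * psiFn x b := by
  simp [psiFn, Nat.cast_mul, map_mul]

/-- `ψχ` is completely multiplicative on `ℕ`. [folklore] -/
private theorem pc_mul [NeZero D] (χ : DirichletCharacter ℂ D) (a b : ℕ) :
    pc χ x (a * b) = pc χ x a * pc χ x b := by
  simp only [pc, Nat.cast_mul, map_mul]; ring

omit x in
/-- A finitely supported sequence has a summable `L`-series everywhere. [folklore] -/
private theorem LSeriesSummable_of_support_le {h : ℕ → ℂ} (N : ℕ) (hN : ∀ n, N ≤ n → h n = 0) (s : ℂ) :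
    LSeriesSummable h s := by
  refine summable_of_ne_finset_zero (s := Finset.range N) fun n hn => ?_
  have hn' : N ≤ n := by simpa using hn
  rcases eq_or_ne n 0 with rfl | h0
  · simp [LSeries.term]
  · rw [LSeries.term_of_ne_zero h0, hN n hn', zero_div]

omit x in
/-- A finite Dirichlet polynomial `Σ_{n ∈ S} a(n)t(n)n^{−s}` whose coefficient `a` vanishes off `S`
(and `0 ∉ S`) is the `L`-series of `a·t`. [folklore] -/
private theorem finsum_eq_LSeries (S : Finset ℕ) (a t : ℕ → ℂ) (h0 : 0 ∉ S)
    (ha : ∀ n, n ≠ 0 → n ∉ S → a n = 0) (s : ℂ) :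
    ∑ n ∈ S, a n * t n * (n : ℂ) ^ (-s) = LSeries (fun n => a n * t n) s := by
  rw [LSeries]
  symm
  rw [tsum_eq_sum (s := S)]
  · refine Finset.sum_congr rfl fun n hn => ?_
    have hn0 : n ≠ 0 := by rintro rfl; exact h0 hn
    rw [LSeries.term_of_ne_zero hn0, div_eq_mul_inv, Complex.cpow_neg]
  · intro n hn
    rcases eq_or_ne n 0 with rfl | hn0
    · simp [LSeries.term]
    · rw [LSeries.term_of_ne_zero hn0, ha n hn0 hn, zero_mul, zero_div]

omit x in
/-- **`b = (ϰ₁·[<P^{1/2}] + ι₂ϰ₂) ∗ (ῑ₃ϰ₃ + ῑ₄ϰ₂)`**: the skeleton's `bcoef` ((15.1), from (12.2) and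
(2.27)) is literally this Dirichlet convolution. [cite: Zhang2022LandauSiegel, §15 (15.1) p.79] -/
theorem bcoef_eq_conv (D : ℕ) :
    bcoef D = (fun n : ℕ => (if (n : ℝ) < bigP D ^ (1 / 2 : ℝ) then vk1 D n else 0) + iota2 * vk2 D n) ⍟
      (fun n : ℕ => conj iota3 * vk3 D n + conj iota4 * vk2 D n) := by
  rw [LSeries.convolution_def]
  funext n
  rfl

omit x in
/-- `ϰ₁(n) = 0` for `n ≥ P₁` (8.6). [cite: Zhang2022LandauSiegel, §8 (8.6) p.44] -/
theorem vk1_eq_zero {D n : ℕ} (h : Skeleton.P1 D ≤ (n : ℝ)) : vk1 D n = 0 := by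
  rw [vk1, if_neg (not_lt.mpr h)]

omit x in
/-- `ϰ₂(n) = 0` for `n ≥ P₂` (8.6). [cite: Zhang2022LandauSiegel, §8 (8.6) p.44] -/
theorem vk2_eq_zero {D n : ℕ} (h : Skeleton.P2 D ≤ (n : ℝ)) : vk2 D n = 0 := by
  rw [vk2, if_neg (not_lt.mpr h)]

omit x in
/-- `ϰ₃(n) = 0` for `n ≥ P₃` (8.6). [cite: Zhang2022LandauSiegel, §8 (8.6) p.44] -/
theorem vk3_eq_zero {D n : ℕ} (h : Skeleton.P3 D ≤ (n : ℝ)) : vk3 D n = 0 := by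
  rw [vk3, if_neg (not_lt.mpr h)]

omit x in
/-- A non-zero `n` outside `[1, ⌈y⌉)` satisfies `y ≤ n`. [folklore] -/
private theorem natCast_ge_of_not_mem_Ico {n : ℕ} {y : ℝ} (hn0 : n ≠ 0) (hn : n ∉ Finset.Ico 1 ⌈y⌉₊) :
    y ≤ n := by
  have : ⌈y⌉₊ ≤ n := by
    by_contra hlt
    exact hn (Finset.mem_Ico.mpr ⟨Nat.one_le_iff_ne_zero.mpr hn0, not_le.mp hlt⟩)
  exact le_trans (Nat.le_ceil _) (by exact_mod_cast this)

/-- `H₁₂(s,ψ) = Σ ϰ₂(n)ψχ(n)n^{−s}` (2.24)/(8.6) as an `L`-series. [cite: Zhang2022LandauSiegel, §2 (2.24) p.7] -/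
theorem H12_eq_LSeries [NeZero D] (χ : DirichletCharacter ℂ D) (s : ℂ) :
    H12 χ x s = LSeries (fun n => vk2 D n * pc χ x n) s := by
  rw [H12]
  exact finsum_eq_LSeries _ _ _ (by simp)
    (fun n hn0 hn => vk2_eq_zero (natCast_ge_of_not_mem_Ico hn0 hn)) s

/-- `H₁₃(s,ψ) = Σ ϰ₃(n)ψχ(n)n^{−s}` (2.25)/(8.6) as an `L`-series. [cite: Zhang2022LandauSiegel, §2 (2.25) p.7] -/
theorem H13_eq_LSeries [NeZero D] (χ : DirichletCharacter ℂ D) (s : ℂ) :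
    H13 χ x s = LSeries (fun n => vk3 D n * pc χ x n) s := by
  rw [H13]
  exact finsum_eq_LSeries _ _ _ (by simp)
    (fun n hn0 hn => vk3_eq_zero (natCast_ge_of_not_mem_Ico hn0 hn)) s

/-- `H₁₄(s,ψ) = Σ_{n<P^{1/2}} ϰ₁(n)ψχ(n)n^{−s}` (12.1) as an `L`-series. [cite: Zhang2022LandauSiegel, §12 (12.1) p.66] -/
theorem H14_eq_LSeries [NeZero D] (χ : DirichletCharacter ℂ D) (s : ℂ) :
    H14 χ x s =
      LSeries (fun n => (if (n : ℝ) < bigP D ^ (1 / 2 : ℝ) then vk1 D n else 0) * pc χ x n) s := by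
  rw [H14]
  have h := finsum_eq_LSeries ((Finset.Ico 1 ⌈Skeleton.P1 D⌉₊).filter (fun n : ℕ => (n : ℝ) < bigP D ^ (1 / 2 : ℝ)))
    (fun n => if (n : ℝ) < bigP D ^ (1 / 2 : ℝ) then vk1 D n else 0) (pc χ x) (by simp) ?_ s
  · rw [← h]
    refine Finset.sum_congr rfl fun n hn => ?_
    rw [if_pos (Finset.mem_filter.mp hn).2]
  · intro n hn0 hn
    rw [Finset.mem_filter, not_and_or] at hn
    rcases hn with hn | hn
    · rw [vk1_eq_zero (natCast_ge_of_not_mem_Ico hn0 hn)]; simp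
    · rw [if_neg hn]

omit x in
/-- Support of the first factor of `b`: it vanishes for `n ≥ max(P₁, P₂)`. [cite: Zhang2022LandauSiegel, §8 (8.6) p.44] -/
theorem bA1_eq_zero {D n : ℕ} (h : max (Skeleton.P1 D) (Skeleton.P2 D) ≤ (n : ℝ)) :
    (if (n : ℝ) < bigP D ^ (1 / 2 : ℝ) then vk1 D n else 0) + iota2 * vk2 D n = 0 := by
  have h1 : Skeleton.P1 D ≤ n := le_trans (le_max_left _ _) h
  have h2 : Skeleton.P2 D ≤ n := le_trans (le_max_right _ _) h
  simp [vk1_eq_zero h1, vk2_eq_zero h2]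

omit x in
/-- Support of the second factor of `b`: it vanishes for `n ≥ max(P₃, P₂)`. [cite: Zhang2022LandauSiegel, §8 (8.6) p.44] -/
theorem bA2_eq_zero {D n : ℕ} (h : max (Skeleton.P3 D) (Skeleton.P2 D) ≤ (n : ℝ)) :
    conj iota3 * vk3 D n + conj iota4 * vk2 D n = 0 := by
  have h1 : Skeleton.P3 D ≤ n := le_trans (le_max_left _ _) h
  have h2 : Skeleton.P2 D ≤ n := le_trans (le_max_right _ _) h
  simp [vk3_eq_zero h1, vk2_eq_zero h2]

/-- Summability of the `ψχ`-twisted first factor of `b` (finite support). [folklore] -/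
private theorem LSeriesSummable_bA1 [NeZero D] (χ : DirichletCharacter ℂ D) (s : ℂ) :
    LSeriesSummable
      (fun n : ℕ => ((if (n : ℝ) < bigP D ^ (1 / 2 : ℝ) then vk1 D n else 0) + iota2 * vk2 D n) *
        pc χ x n) s := by
  refine LSeriesSummable_of_support_le ⌈max (Skeleton.P1 D) (Skeleton.P2 D)⌉₊ (fun n hn => ?_) s
  rw [bA1_eq_zero (le_trans (Nat.le_ceil _) (by exact_mod_cast hn)), zero_mul]

/-- Summability of the `ψχ`-twisted second factor of `b` (finite support). [folklore] -/
private theorem LSeriesSummable_bA2 [NeZero D] (χ : DirichletCharacter ℂ D) (s : ℂ) :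
    LSeriesSummable (fun n : ℕ => (conj iota3 * vk3 D n + conj iota4 * vk2 D n) * pc χ x n) s := by
  refine LSeriesSummable_of_support_le ⌈max (Skeleton.P3 D) (Skeleton.P2 D)⌉₊ (fun n hn => ?_) s
  rw [bA2_eq_zero (le_trans (Nat.le_ceil _) (by exact_mod_cast hn)), zero_mul]

/-- `H₁₄(s,ψ) + ι₂H₁₂(s,ψ) = Σ_n (ϰ₁(n)[n<P^{1/2}] + ι₂ϰ₂(n))ψχ(n)n^{−s}` ((12.1)–(12.2)) as an
`L`-series. [cite: Zhang2022LandauSiegel, §12 (12.2) p.66] -/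
theorem H14_add_eq_LSeries [NeZero D] (χ : DirichletCharacter ℂ D) (s : ℂ) :
    H14 χ x s + iota2 * H12 χ x s =
      LSeries (fun n : ℕ => ((if (n : ℝ) < bigP D ^ (1 / 2 : ℝ) then vk1 D n else 0) +
        iota2 * vk2 D n) * pc χ x n) s := by
  have hsum1 : LSeriesSummable
      (fun n => (if (n : ℝ) < bigP D ^ (1 / 2 : ℝ) then vk1 D n else 0) * pc χ x n) s :=
    LSeriesSummable_of_support_le ⌈Skeleton.P1 D⌉₊ (fun n hn => by
      rw [vk1_eq_zero (le_trans (Nat.le_ceil _) (by exact_mod_cast hn))]; simp) s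
  have hsum2 : LSeriesSummable (fun n => vk2 D n * pc χ x n) s :=
    LSeriesSummable_of_support_le ⌈Skeleton.P2 D⌉₊ (fun n hn => by
      rw [vk2_eq_zero (le_trans (Nat.le_ceil _) (by exact_mod_cast hn)), zero_mul]) s
  have hfun : (fun n : ℕ => ((if (n : ℝ) < bigP D ^ (1 / 2 : ℝ) then vk1 D n else 0) +
        iota2 * vk2 D n) * pc χ x n) =
      (fun n : ℕ => (if (n : ℝ) < bigP D ^ (1 / 2 : ℝ) then vk1 D n else 0) * pc χ x n) +
        iota2 • (fun n : ℕ => vk2 D n * pc χ x n) := by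
    funext n; simp only [Pi.add_apply, Pi.smul_apply, smul_eq_mul]; ring
  rw [hfun, LSeries_add hsum1 (hsum2.smul _), LSeries_smul, H14_eq_LSeries, H12_eq_LSeries]

/-- `H₂(s,ψ) = Σ_n (ῑ₃ϰ₃(n) + ῑ₄ϰ₂(n))ψχ(n)n^{−s}` (2.27) as an `L`-series.
[cite: Zhang2022LandauSiegel, §2 (2.27) p.7] -/
theorem H2_eq_LSeries [NeZero D] (χ : DirichletCharacter ℂ D) (s : ℂ) :
    H2 χ x s = LSeries (fun n : ℕ => (conj iota3 * vk3 D n + conj iota4 * vk2 D n) * pc χ x n) s := by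
  have hsum3 : LSeriesSummable (fun n => vk3 D n * pc χ x n) s :=
    LSeriesSummable_of_support_le ⌈Skeleton.P3 D⌉₊ (fun n hn => by
      rw [vk3_eq_zero (le_trans (Nat.le_ceil _) (by exact_mod_cast hn)), zero_mul]) s
  have hsum2 : LSeriesSummable (fun n => vk2 D n * pc χ x n) s :=
    LSeriesSummable_of_support_le ⌈Skeleton.P2 D⌉₊ (fun n hn => by
      rw [vk2_eq_zero (le_trans (Nat.le_ceil _) (by exact_mod_cast hn)), zero_mul]) s
  have hfun : (fun n : ℕ => (conj iota3 * vk3 D n + conj iota4 * vk2 D n) * pc χ x n) =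
      conj iota3 • (fun n : ℕ => vk3 D n * pc χ x n) +
        conj iota4 • (fun n : ℕ => vk2 D n * pc χ x n) := by
    funext n; simp only [Pi.add_apply, Pi.smul_apply, smul_eq_mul]; ring
  rw [hfun, LSeries_add (hsum3.smul _) (hsum2.smul _), LSeries_smul, LSeries_smul, H2,
    H13_eq_LSeries, H12_eq_LSeries]

/-- **`B(s,ψ) = Σ_n b(n)ψχ(n)n^{−s}` (15.1)** for the skeleton's `Bpoly` and `bcoef`, as an
`L`-series identity valid at every `s` (both sides finite). Display (15.1), kernel-checked.
[cite: Zhang2022LandauSiegel, §15 (15.1) p.79] -/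
theorem Bpoly_eq_LSeries [NeZero D] (χ : DirichletCharacter ℂ D) (s : ℂ) :
    Bpoly χ x s = LSeries (fun n => bcoef D n * pc χ x n) s := by
  rw [Bpoly, H14_add_eq_LSeries, H2_eq_LSeries,
    ← LSeries_convolution' (LSeriesSummable_bA1 x χ s) (LSeriesSummable_bA2 x χ s),
    convolution_mul_of_map_mul _ (pc_mul x χ), bcoef_eq_conv]

/-- Summability of `Σ b(n)ψχ(n)n^{−s}` at every `s` (finite support, (15.2)). [cite: Zhang2022LandauSiegel, §15 (15.2) p.79] -/
theorem LSeriesSummable_bcoef [NeZero D] (χ : DirichletCharacter ℂ D) (s : ℂ) :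
    LSeriesSummable (fun n => bcoef D n * pc χ x n) s := by
  rw [bcoef_eq_conv, ← convolution_mul_of_map_mul _ (pc_mul x χ)]
  exact (LSeriesSummable_bA1 x χ s).convolution (LSeriesSummable_bA2 x χ s)

/-- A `ψ`-twisted Dirichlet series written with `n^{−s}` is the `LSeries` of the twisted sequence
(when the sequence vanishes at `0`). [folklore] -/
private theorem tsum_mul_psi_cpow_eq_LSeries (h : ℕ → ℂ) (h0 : h 0 = 0) (s : ℂ) :
    ∑' n : ℕ, h n * x.ψ (n : ZMod x.p) * (n : ℂ) ^ (-s) = LSeries (fun n => h n * psiFn x n) s := by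
  refine tsum_congr fun n => ?_
  rcases eq_or_ne n 0 with rfl | hn
  · simp [h0, LSeries.term]
  · rw [LSeries.term_of_ne_zero hn, psiFn, div_eq_mul_inv, Complex.cpow_neg]

omit x in
/-- `nN D β n = 0` for `n ≥ 2T²` (`g*(T²/n) = 0` there) and at `n = 0`. [cite: Zhang2022LandauSiegel, §6 p.30] -/
theorem nN_eq_zero_of_le (D : ℕ) (β : ℂ) {n : ℕ} (hn : 2 * bigT D ^ 2 ≤ n) : nN D β n = 0 := by
  have hT : 0 < bigT D := Real.exp_pos _
  have hn0 : (0 : ℝ) < n := lt_of_lt_of_le (by positivity) hn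
  have : ¬ (1 / 2 : ℝ) < bigT D ^ 2 / n := by
    rw [not_lt, div_le_iff₀ hn0]
    linarith
  unfold nN gstar
  rw [if_neg this]
  simp

omit x in
/-- `nN D β 0 = 0` (the value at `0`, irrelevant under convolution). [folklore] -/
private theorem nN_zero (D : ℕ) (β : ℂ) : nN D β 0 = 0 := by
  simp [nN, gstar]

/-- `G(s,ψ)` as the `L`-series of `υ·[n ≤ D⁴]·ψ`. [cite: Zhang2022LandauSiegel, §3 p.12] -/
theorem Gpoly_eq_LSeries [NeZero D] (χ : DirichletCharacter ℂ D) (s : ℂ) :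
    Gpoly χ x s = LSeries (fun n => trunc (D ^ 4) (ups χ) n * psiFn x n) s := by
  rw [Gpoly, LSeries]
  symm
  rw [tsum_eq_sum (s := Finset.Icc 1 (D ^ 4))]
  · refine Finset.sum_congr rfl fun n hn => ?_
    have hn1 : 1 ≤ n := (Finset.mem_Icc.mp hn).1
    have hnD : n ≤ D ^ 4 := (Finset.mem_Icc.mp hn).2
    rw [LSeries.term_of_ne_zero (by omega), trunc, if_pos hnD, psiFn, div_eq_mul_inv,
      Complex.cpow_neg]
  · intro n hn
    rcases eq_or_ne n 0 with rfl | h0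
    · simp [LSeries.term]
    · have hnD : ¬ n ≤ D ^ 4 := by
        intro h; exact hn (Finset.mem_Icc.mpr ⟨Nat.one_le_iff_ne_zero.mpr h0, h⟩)
      rw [LSeries.term_of_ne_zero h0, trunc, if_neg hnD, zero_mul, zero_div]

/-- `N(s+β,ψ)` as the `L`-series of `nN β · ψ` at `s`. [cite: Zhang2022LandauSiegel, §6 p.30] -/
theorem Nchar_shift_eq_LSeries (β s : ℂ) :
    Nchar D (psiFn x) (s + β) = LSeries (fun n => nN D β n * psiFn x n) s := by
  rw [Nchar, LSeries]
  symm
  rw [tsum_eq_sum (s := Finset.Ico 1 ⌈2 * bigT D ^ 2⌉₊)]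
  · refine Finset.sum_congr rfl fun n hn => ?_
    have hn1 : 1 ≤ n := (Finset.mem_Ico.mp hn).1
    have hn0 : (n : ℂ) ≠ 0 := by exact_mod_cast (show n ≠ 0 by omega)
    rw [LSeries.term_of_ne_zero (by omega), nN, psiFn, div_eq_mul_inv, ← Complex.cpow_neg,
      neg_add, Complex.cpow_add _ _ hn0]
    ring
  · intro n hn
    rcases eq_or_ne n 0 with rfl | h0
    · simp [LSeries.term]
    · have hge : ⌈2 * bigT D ^ 2⌉₊ ≤ n := by
        by_contra hlt
        exact hn (Finset.mem_Ico.mpr ⟨Nat.one_le_iff_ne_zero.mpr h0, not_le.mp hlt⟩)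
      have hreal : 2 * bigT D ^ 2 ≤ (n : ℝ) := le_trans (Nat.le_ceil _) (by exact_mod_cast hge)
      rw [LSeries.term_of_ne_zero h0, nN_eq_zero_of_le D β hreal, zero_mul, zero_div]


/-- Product of two `ψ`-twisted `L`-series = the twisted `L`-series of the convolution, with its
summability. [folklore] -/
private theorem LSeries_mul_twist {f g : ℕ → ℂ} {s : ℂ} (hf : LSeriesSummable (fun n => f n * psiFn x n) s)
    (hg : LSeriesSummable (fun n => g n * psiFn x n) s) :
    LSeries (fun n => f n * psiFn x n) s * LSeries (fun n => g n * psiFn x n) s =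
        LSeries (fun n => (f ⍟ g) n * psiFn x n) s ∧
      LSeriesSummable (fun n => (f ⍟ g) n * psiFn x n) s := by
  rw [← convolution_mul_of_map_mul _ (psiFn_mul x), LSeries_convolution' hf hg]
  exact ⟨rfl, hf.convolution hg⟩


/-- `L(s+β₁,ψ) = Σ_n n^{−β₁}ψ(n)n^{−s}` for `Re s > 1` (the shift is purely imaginary).
[cite: Zhang2022LandauSiegel, §16 p.89] -/
theorem LFunction_shift_eq_LSeries (c' : ℝ) (s : ℂ) (hs : 1 < s.re) :
    x.ψ.LFunction (s + beta1 c' D) =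
      LSeries (fun n => MeanSquareMajorant.powI (b1 c' D) n * psiFn x n) s := by
  have hs' : 1 < (s + beta1 c' D).re := by rw [Complex.add_re, Typed.Section13.beta1_re, add_zero]; exact hs
  rw [DirichletCharacter.LFunction_eq_LSeries _ hs', LSeries, LSeries]
  refine tsum_congr fun n => ?_
  rcases eq_or_ne n 0 with rfl | hn
  · simp [LSeries.term]
  · have hn' : (n : ℂ) ≠ 0 := by exact_mod_cast hn
    rw [LSeries.term_of_ne_zero hn, LSeries.term_of_ne_zero hn,
      MeanSquareMajorant.powI_apply_of_ne_zero _ hn, psiFn, ← beta1_eq_b1I,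
      Complex.cpow_add _ _ hn', Complex.cpow_neg]
    field_simp

/-- Summability of `Σ n^{−ib}ψ(n)n^{−s}` at `Re s > 1` (coefficients of modulus `≤ 1`). [folklore] -/
private theorem LSeriesSummable_powI_psi (b : ℝ) {s : ℂ} (hs : 1 < s.re) :
    LSeriesSummable (fun n => MeanSquareMajorant.powI b n * psiFn x n) s := by
  refine LSeriesSummable_of_bounded_of_one_lt_re (m := 1) (fun n hn => ?_) hs
  rw [norm_mul, MeanSquareMajorant.norm_powI_of_pos b (Nat.pos_of_ne_zero hn), one_mul]
  exact x.ψ.norm_le_one _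

/-- Summability of `Σ μ(n)ψ(n)n^{−s}` at `Re s > 1` (Mathlib). [folklore] -/
private theorem LSeriesSummable_moebius_psi {s : ℂ} (hs : 1 < s.re) :
    LSeriesSummable (fun n => ((ArithmeticFunction.moebius : ArithmeticFunction ℂ) n) * psiFn x n) s := by
  have h := DirichletCharacter.LSeriesSummable_mul x.ψ
    (ArithmeticFunction.LSeriesSummable_moebius_iff.mpr hs)
  refine (LSeriesSummable_congr s fun {n} _ => ?_).mp h
  simp [psiFn, ArithmeticFunction.intCoe_apply, mul_comm]

/-- **`L(s+β₁,ψ)/L(s,ψ) = Σ κ₂(n)ψ(n)n^{−s}`** for `Re s > 1` (`κ₂ = n^{−β₁}∗μ`, the tree's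
`MeanSquareMajorant.kappa₂ (b1 c′ D)`; §16 p. 89 "`Σκ₂(n)n^{−s} = ζ(s+β₁)/ζ(s)`", twisted by `ψ`), with
the summability of the right side. [cite: Zhang2022LandauSiegel, §16 p.89] -/
theorem LRatio_eq_LSeries (c' : ℝ) (s : ℂ) (hs : 1 < s.re) :
    x.ψ.LFunction (s + beta1 c' D) / x.ψ.LFunction s =
        LSeries (fun n => MeanSquareMajorant.kappa₂ (b1 c' D) n * psiFn x n) s ∧
      LSeriesSummable (fun n => MeanSquareMajorant.kappa₂ (b1 c' D) n * psiFn x n) s := by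
  have hmu : LSeries (fun n : ℕ => x.ψ (n : ZMod x.p)) s *
      LSeries ((fun n : ℕ => x.ψ (n : ZMod x.p)) * (fun n : ℕ => (ArithmeticFunction.moebius n : ℂ))) s = 1 :=
    DirichletCharacter.LSeries.mul_mu_eq_one x.ψ hs
  have hL : x.ψ.LFunction s = LSeries (fun n : ℕ => x.ψ (n : ZMod x.p)) s :=
    DirichletCharacter.LFunction_eq_LSeries _ hs
  have hμψ : ((fun n : ℕ => x.ψ (n : ZMod x.p)) * (fun n : ℕ => (ArithmeticFunction.moebius n : ℂ))) =
      fun n => ((ArithmeticFunction.moebius : ArithmeticFunction ℂ) n) * psiFn x n := by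
    funext n; simp [psiFn, ArithmeticFunction.intCoe_apply, mul_comm]
  rw [hμψ] at hmu
  have hinv : (x.ψ.LFunction s)⁻¹ =
      LSeries (fun n => ((ArithmeticFunction.moebius : ArithmeticFunction ℂ) n) * psiFn x n) s := by
    rw [hL]; exact inv_eq_of_mul_eq_one_right hmu
  have hk : (fun n => MeanSquareMajorant.powI (b1 c' D) n) ⍟
      (fun n => (ArithmeticFunction.moebius : ArithmeticFunction ℂ) n) =
        fun n => MeanSquareMajorant.kappa₂ (b1 c' D) n := by
    rw [MeanSquareMajorant.kappa₂]
    exact ArithmeticFunction.coe_mul _ _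
  obtain ⟨hprod, hsum⟩ := LSeries_mul_twist x (LSeriesSummable_powI_psi x (b1 c' D) hs)
    (LSeriesSummable_moebius_psi x hs)
  rw [hk] at hprod hsum
  refine ⟨?_, hsum⟩
  rw [div_eq_mul_inv, hinv, LFunction_shift_eq_LSeries x c' s hs, hprod]

/-- **§17.u004 DISCHARGED** (§17 p. 96): for `Re s > 1` and every `ψ ∈ Ψ`,
`(L(s+β₁,ψ)/L(s,ψ))B(s,ψ)G(s,ψ)N(s+β₂,ψ)N(s+β₃,ψ) = Σ_m ν*(m)ψ(m)m^{−s}` with the typed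
`ν* = Typed.Section17.nuStar` — so the object `nuStar` IS the manuscript's `ν*`. DAG `Z22:§17.u004`
[Z22 p.96, tex L4719]. [cite: Zhang2022LandauSiegel, §17 u004 p.96] -/
theorem step17_u004_holds (c' : ℝ) [NeZero D] (χ : DirichletCharacter ℂ D) : Step17_u004 c' χ := by
  intro x s hs
  have h0 : nuStar c' χ 0 = 0 := by simp [nuStar]
  obtain ⟨hR, hRs⟩ := LRatio_eq_LSeries x c' s hs
  -- the b-factor in ψ-twisted form
  have hb : (fun n => bcoef D n * pc χ x n) = fun n => (bcoef D n * χ (n : ZMod D)) * psiFn x n := by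
    funext n; simp only [pc, psiFn]; ring
  have hBs : LSeriesSummable (fun n => (bcoef D n * χ (n : ZMod D)) * psiFn x n) s := by
    rw [← hb]; exact LSeriesSummable_bcoef x χ s
  have hB : Bpoly χ x s = LSeries (fun n => (bcoef D n * χ (n : ZMod D)) * psiFn x n) s := by
    rw [Bpoly_eq_LSeries, hb]
  have hGs : LSeriesSummable (fun n => trunc (D ^ 4) (ups χ) n * psiFn x n) s := by
    refine LSeriesSummable_of_support_le (D ^ 4 + 1) (fun n hn => ?_) s
    have : ¬ n ≤ D ^ 4 := by omega
    simp [trunc, this]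
  have hNs : ∀ β : ℂ, LSeriesSummable (fun n => nN D β n * psiFn x n) s := by
    intro β
    refine LSeriesSummable_of_support_le ⌈2 * bigT D ^ 2⌉₊ (fun n hn => ?_) s
    have hreal : 2 * bigT D ^ 2 ≤ (n : ℝ) := le_trans (Nat.le_ceil _) (by exact_mod_cast hn)
    rw [nN_eq_zero_of_le D β hreal, zero_mul]
  obtain ⟨h1, s1⟩ := LSeries_mul_twist x hRs hBs
  obtain ⟨h2, s2⟩ := LSeries_mul_twist x s1 hGs
  obtain ⟨h3, s3⟩ := LSeries_mul_twist x s2 (hNs (beta2 c' D))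
  obtain ⟨h4, _⟩ := LSeries_mul_twist x s3 (hNs (beta3 c' D))
  rw [tsum_mul_psi_cpow_eq_LSeries x _ h0, hR, hB, Gpoly_eq_LSeries x χ s, Nchar_shift_eq_LSeries x,
    Nchar_shift_eq_LSeries x, h1, h2, h3, h4, nuStar]

/-- **§17.u014 DISCHARGED** (§17 p. 97): `G(s,ψ)N(s+β₂,ψ)N(s+β₃,ψ) = Σ_l ν₁*(l)ψ(l)l^{−s}` for every
`ψ ∈ Ψ` and every `s` (three finite Dirichlet polynomials; `ν₁* = Typed.Section17.nuOneStar`).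
DAG `Z22:§17.u014` [Z22 p.97, tex L4793]. [cite: Zhang2022LandauSiegel, §17 u014 p.97] -/
theorem step17_u014_holds (c' : ℝ) [NeZero D] (χ : DirichletCharacter ℂ D) : Step17_u014 c' χ := by
  intro x s
  have h0 : nuOneStar c' χ 0 = 0 := by simp [nuOneStar]
  have hs1 : LSeriesSummable (fun n => trunc (D ^ 4) (ups χ) n * psiFn x n) s := by
    refine LSeriesSummable_of_support_le (D ^ 4 + 1) (fun n hn => ?_) s
    have : ¬ n ≤ D ^ 4 := by omega
    simp [trunc, this]
  have hsN : ∀ β : ℂ, LSeriesSummable (fun n => nN D β n * psiFn x n) s := by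
    intro β
    refine LSeriesSummable_of_support_le ⌈2 * bigT D ^ 2⌉₊ (fun n hn => ?_) s
    have hreal : 2 * bigT D ^ 2 ≤ (n : ℝ) := le_trans (Nat.le_ceil _) (by exact_mod_cast hn)
    rw [nN_eq_zero_of_le D β hreal, zero_mul]
  obtain ⟨h1, s1⟩ := LSeries_mul_twist x hs1 (hsN (beta2 c' D))
  obtain ⟨h2, _⟩ := LSeries_mul_twist x s1 (hsN (beta3 c' D))
  rw [tsum_mul_psi_cpow_eq_LSeries x _ h0, Gpoly_eq_LSeries x χ s, Nchar_shift_eq_LSeries x,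
    Nchar_shift_eq_LSeries x, h1, h2, nuOneStar]

end DischargesB

/-! ## §17.u016 and §17.u017 (`l ≤ D⁴` reading): the `σ < 0` identities with `ψ̄` -/

section DischargesC

variable {N : ℕ} (θ : DirichletCharacter ℂ N)

/-- A Dirichlet character is completely multiplicative on `ℕ`. [folklore] -/
private theorem dc_mul (a b : ℕ) : θ ((a * b : ℕ) : ZMod N) = θ (a : ZMod N) * θ (b : ZMod N) := by
  simp [Nat.cast_mul, map_mul]

/-- Product of two `θ`-twisted `L`-series = twisted `L`-series of the convolution (+ summability). [folklore] -/
private theorem LSeries_mul_twist_gen {f g : ℕ → ℂ} {s : ℂ}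
    (hf : LSeriesSummable (fun n => f n * θ (n : ZMod N)) s)
    (hg : LSeriesSummable (fun n => g n * θ (n : ZMod N)) s) :
    LSeries (fun n => f n * θ (n : ZMod N)) s * LSeries (fun n => g n * θ (n : ZMod N)) s =
        LSeries (fun n => (f ⍟ g) n * θ (n : ZMod N)) s ∧
      LSeriesSummable (fun n => (f ⍟ g) n * θ (n : ZMod N)) s := by
  rw [← convolution_mul_of_map_mul _ (dc_mul θ), LSeries_convolution' hf hg]
  exact ⟨rfl, hf.convolution hg⟩

/-- `L(s + ib,θ) = Σ_n n^{−ib}θ(n)n^{−s}` for `Re s > 1` (a purely imaginary shift moves into the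
coefficient). [folklore] -/
private theorem LFunction_shiftI_eq_LSeries [NeZero N] (b : ℝ) (s : ℂ) (hs : 1 < s.re) :
    θ.LFunction (s + b * I) =
      LSeries (fun n => MeanSquareMajorant.powI b n * θ (n : ZMod N)) s := by
  have hs' : 1 < (s + b * I).re := by simp [hs]
  rw [DirichletCharacter.LFunction_eq_LSeries _ hs', LSeries, LSeries]
  refine tsum_congr fun n => ?_
  rcases eq_or_ne n 0 with rfl | hn
  · simp [LSeries.term]
  · have hn' : (n : ℂ) ≠ 0 := by exact_mod_cast hn
    rw [LSeries.term_of_ne_zero hn, LSeries.term_of_ne_zero hn,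
      MeanSquareMajorant.powI_apply_of_ne_zero _ hn, Complex.cpow_add _ _ hn', Complex.cpow_neg]
    field_simp

/-- Summability of `Σ n^{−ib}θ(n)n^{−s}` at `Re s > 1`. [folklore] -/
private theorem LSeriesSummable_powI_twist (b : ℝ) {s : ℂ} (hs : 1 < s.re) :
    LSeriesSummable (fun n => MeanSquareMajorant.powI b n * θ (n : ZMod N)) s := by
  refine LSeriesSummable_of_bounded_of_one_lt_re (m := 1) (fun n hn => ?_) hs
  rw [norm_mul, MeanSquareMajorant.norm_powI_of_pos b (Nat.pos_of_ne_zero hn), one_mul]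
  exact θ.norm_le_one _

/-- Summability of `Σ μ(n)θ(n)n^{−s}` at `Re s > 1`. [folklore] -/
private theorem LSeriesSummable_moebius_twist {s : ℂ} (hs : 1 < s.re) :
    LSeriesSummable (fun n => ((ArithmeticFunction.moebius : ArithmeticFunction ℂ) n) * θ (n : ZMod N)) s := by
  have h := DirichletCharacter.LSeriesSummable_mul θ
    (ArithmeticFunction.LSeriesSummable_moebius_iff.mpr hs)
  refine (LSeriesSummable_congr s fun {n} _ => ?_).mp h
  simp [ArithmeticFunction.intCoe_apply, mul_comm]

/-- **`L(s + ib,θ)/L(s,θ) = Σ_n κ₂^{(b)}(n)θ(n)n^{−s}`** for `Re s > 1`, `κ₂^{(b)} = n^{−ib} ∗ μ` (the tree's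
`MeanSquareMajorant.kappa₂ b`), with summability — the generating identity "`Σκ₂(n)n^{−s} =
ζ(s+β₁)/ζ(s)`" of §16 p. 89 twisted by a Dirichlet character. [cite: Zhang2022LandauSiegel, §16 p.89] -/
theorem LFunction_ratio_eq_LSeries_kappa₂ [NeZero N] (b : ℝ) (s : ℂ) (hs : 1 < s.re) :
    θ.LFunction (s + b * I) / θ.LFunction s =
        LSeries (fun n => MeanSquareMajorant.kappa₂ b n * θ (n : ZMod N)) s ∧
      LSeriesSummable (fun n => MeanSquareMajorant.kappa₂ b n * θ (n : ZMod N)) s := by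
  have hmu : LSeries (fun n : ℕ => θ (n : ZMod N)) s *
      LSeries ((fun n : ℕ => θ (n : ZMod N)) * (fun n : ℕ => (ArithmeticFunction.moebius n : ℂ))) s = 1 :=
    DirichletCharacter.LSeries.mul_mu_eq_one θ hs
  have hL : θ.LFunction s = LSeries (fun n : ℕ => θ (n : ZMod N)) s :=
    DirichletCharacter.LFunction_eq_LSeries _ hs
  have hμ : ((fun n : ℕ => θ (n : ZMod N)) * (fun n : ℕ => (ArithmeticFunction.moebius n : ℂ))) =
      fun n => ((ArithmeticFunction.moebius : ArithmeticFunction ℂ) n) * θ (n : ZMod N) := by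
    funext n; simp [ArithmeticFunction.intCoe_apply, mul_comm]
  rw [hμ] at hmu
  have hinv : (θ.LFunction s)⁻¹ =
      LSeries (fun n => ((ArithmeticFunction.moebius : ArithmeticFunction ℂ) n) * θ (n : ZMod N)) s := by
    rw [hL]; exact inv_eq_of_mul_eq_one_right hmu
  have hk : (fun n => MeanSquareMajorant.powI b n) ⍟
      (fun n => (ArithmeticFunction.moebius : ArithmeticFunction ℂ) n) =
        fun n => MeanSquareMajorant.kappa₂ b n := by
    rw [MeanSquareMajorant.kappa₂]
    exact ArithmeticFunction.coe_mul _ _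
  obtain ⟨hprod, hsum⟩ := LSeries_mul_twist_gen θ (LSeriesSummable_powI_twist θ b hs)
    (LSeriesSummable_moebius_twist θ hs)
  rw [hk] at hprod hsum
  refine ⟨?_, hsum⟩
  rw [div_eq_mul_inv, hinv, LFunction_shiftI_eq_LSeries θ b s hs, hprod]

end DischargesC

section DischargesD

variable (c' : ℝ) {D : ℕ} [NeZero D] (χ : DirichletCharacter ℂ D)

omit [NeZero D] χ in
/-- `conj ψ(a) = ψ̄(a) = ψ⁻¹(a)`. [folklore] -/
private theorem conj_psi_apply (x : Chr D) (a : ZMod x.p) : conj (x.ψ a) = x.ψ⁻¹ a := by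
  rw [← MulChar.star_apply']
  rfl

omit [NeZero D] χ in
/-- **`κ̄₂ = κ₂^{(−b₁)}`**: conjugating `κ₂ = n^{−ib₁} ∗ μ` flips the sign of the shift. [cite: Zhang2022LandauSiegel, §17 u016 p.97] -/
theorem kappa2bar_eq_kappa₂_neg (m : ℕ) :
    kappa2bar c' D m = MeanSquareMajorant.kappa₂ (-(b1 c' D)) m := by
  rw [kappa2bar, MeanSquareMajorant.kappa₂, MeanSquareMajorant.kappa₂, ArithmeticFunction.mul_apply,
    ArithmeticFunction.mul_apply, map_sum]
  refine Finset.sum_congr rfl fun p hp => ?_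
  have hp1 : p.1 ≠ 0 := by
    have := (Nat.mem_divisorsAntidiagonal.mp hp).2
    intro h; apply this; simp [← (Nat.mem_divisorsAntidiagonal.mp hp).1, h]
  rw [map_mul, MeanSquareMajorant.powI_apply_of_ne_zero _ hp1,
    MeanSquareMajorant.powI_apply_of_ne_zero _ hp1, ArithmeticFunction.intCoe_apply, map_intCast]
  congr 1
  have harg : (p.1 : ℂ).arg ≠ π := by rw [Complex.natCast_arg]; exact Real.pi_pos.ne
  have h := Complex.conj_cpow (p.1 : ℂ) (((b1 c' D : ℝ) : ℂ) * I) harg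
  rw [Complex.conj_natCast] at h
  have hc : conj (((b1 c' D : ℝ) : ℂ) * I) = -(((b1 c' D : ℝ) : ℂ) * I) := by
    simp [Complex.conj_ofReal]
  rw [hc] at h
  have hneg : -(((-(b1 c' D) : ℝ) : ℂ) * I) = ((b1 c' D : ℝ) : ℂ) * I := by push_cast; ring
  rw [hneg, h]

omit [NeZero D] χ in
/-- **§17.u016 DISCHARGED** (§17 p. 97): for `σ < 0` and every `ψ ∈ Ψ`,
`L(1−s−β₁,ψ̄)/L(1−s,ψ̄) = Σ_m κ̄₂(m)ψ̄(m)m^{−(1−s)}` (`ψ̄ = ψ⁻¹`, `κ̄₂ = conj κ₂`). DAG `Z22:§17.u016`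
[Z22 p.97, tex L4801]. [cite: Zhang2022LandauSiegel, §17 u016 p.97] -/
theorem step17_u016_holds : Step17_u016 c' (D := D) := by
  intro x s hs
  have hw : 1 < (1 - s).re := by simp; linarith
  have hshift : (1 : ℂ) - s - beta1 c' D = (1 - s) + ((-(b1 c' D) : ℝ) : ℂ) * I := by
    simp only [beta1, b1]; push_cast; ring
  obtain ⟨h, -⟩ := LFunction_ratio_eq_LSeries_kappa₂ x.ψ⁻¹ (-(b1 c' D)) (1 - s) hw
  rw [hshift, h, LSeries]
  refine tsum_congr fun n => ?_
  rcases eq_or_ne n 0 with rfl | hn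
  · simp [LSeries.term, kappa2bar, MeanSquareMajorant.kappa₂]
  · rw [LSeries.term_of_ne_zero hn, kappa2bar_eq_kappa₂_neg, conj_psi_apply, div_eq_mul_inv,
      Complex.cpow_neg]


omit [NeZero D] in
/-- `F(w,ψ̄) = Σ_{n≤D⁴} ν(n)ψ̄(n)n^{−w}` as the `L`-series of `ν·[≤D⁴]·ψ⁻¹`. [cite: Zhang2022LandauSiegel, §3 p.12] -/
theorem FpolyBar_eq_LSeries (x : Chr D) (w : ℂ) :
    FpolyBar χ x w = LSeries (fun n => trunc (D ^ 4) (nu χ) n * x.ψ⁻¹ (n : ZMod x.p)) w := by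
  rw [FpolyBar, LSeries]
  symm
  rw [tsum_eq_sum (s := Finset.Icc 1 (D ^ 4))]
  · refine Finset.sum_congr rfl fun n hn => ?_
    have hn1 : 1 ≤ n := (Finset.mem_Icc.mp hn).1
    have hnD : n ≤ D ^ 4 := (Finset.mem_Icc.mp hn).2
    rw [LSeries.term_of_ne_zero (by omega), trunc, if_pos hnD, ← conj_psi_apply, div_eq_mul_inv,
      Complex.cpow_neg]
  · intro n hn
    rcases eq_or_ne n 0 with rfl | h0
    · simp [LSeries.term]
    · have hnD : ¬ n ≤ D ^ 4 := by
        intro h; exact hn (Finset.mem_Icc.mpr ⟨Nat.one_le_iff_ne_zero.mpr h0, h⟩)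
      rw [LSeries.term_of_ne_zero h0, trunc, if_neg hnD, zero_mul, zero_div]

omit [NeZero D] in
/-- **§17.u017 in the `l ≤ D⁴` reading, DISCHARGED** (§17 p. 97): for `σ < 0` and every `ψ ∈ Ψ`,
`(L(1−s−β₁,ψ̄)/L(1−s,ψ̄))F(1−s,ψ̄) = Σ_n ϱ*_≤(n)ψ̄(n)n^{−(1−s)}` with `ϱ*_≤ = (ν·[≤D⁴]) ∗ κ̄₂`. The typed
node `Step17_u017` uses the PRINTED `ϱ*(n) = Σ_{n=lm, l<D⁴} ν(l)κ̄₂(m)` (`varrho17`, flag (i) of the typed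
file: `F(1−s,ψ̄)` runs over `n ≤ D⁴`, §3), which differs from `ϱ*_≤` by the boundary term `l = D⁴`
(`ν(D⁴) = 1`); the identity that actually holds for the skeleton's `FpolyBar` is this one.
[cite: Zhang2022LandauSiegel, §17 u017 p.97] -/
theorem step17_u017_le_holds (x : Chr D) (s : ℂ) (hs : s.re < 0) :
    DirichletCharacter.LFunction x.ψ⁻¹ (1 - s - beta1 c' D) /
        DirichletCharacter.LFunction x.ψ⁻¹ (1 - s) * FpolyBar χ x (1 - s) =
      ∑' n : ℕ, (LSeries.convolution (trunc (D ^ 4) (nu χ)) (kappa2bar c' D)) n *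
        conj (x.ψ (n : ZMod x.p)) * (n : ℂ) ^ (-(1 - s)) := by
  have hw : 1 < (1 - s).re := by simp; linarith
  have hshift : (1 : ℂ) - s - beta1 c' D = (1 - s) + ((-(b1 c' D) : ℝ) : ℂ) * I := by
    simp only [beta1, b1]; push_cast; ring
  obtain ⟨h, hsum⟩ := LFunction_ratio_eq_LSeries_kappa₂ x.ψ⁻¹ (-(b1 c' D)) (1 - s) hw
  have hk : (fun n => MeanSquareMajorant.kappa₂ (-(b1 c' D)) n * x.ψ⁻¹ (n : ZMod x.p)) =
      fun n => kappa2bar c' D n * x.ψ⁻¹ (n : ZMod x.p) := by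
    funext n; rw [kappa2bar_eq_kappa₂_neg]
  rw [hk] at h hsum
  have hF : LSeriesSummable (fun n => trunc (D ^ 4) (nu χ) n * x.ψ⁻¹ (n : ZMod x.p)) (1 - s) := by
    refine summable_of_ne_finset_zero (s := Finset.range (D ^ 4 + 1)) fun n hn => ?_
    have hn' : D ^ 4 + 1 ≤ n := by simpa using hn
    have : ¬ n ≤ D ^ 4 := by omega
    rw [LSeries.term_of_ne_zero (by omega), trunc, if_neg this, zero_mul, zero_div]
  obtain ⟨hprod, -⟩ := LSeries_mul_twist_gen x.ψ⁻¹ hsum hF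
  have hcomm : LSeries.convolution (kappa2bar c' D) (trunc (D ^ 4) (nu χ)) =
      LSeries.convolution (trunc (D ^ 4) (nu χ)) (kappa2bar c' D) := by
    simp only [LSeries.convolution, mul_comm]
  rw [hshift, h, FpolyBar_eq_LSeries, hprod, hcomm, LSeries]
  refine tsum_congr fun n => ?_
  rcases eq_or_ne n 0 with rfl | hn
  · simp [LSeries.term]
  · rw [LSeries.term_of_ne_zero hn, conj_psi_apply, div_eq_mul_inv, Complex.cpow_neg]

end DischargesD

/-! ## Merge: the sibling slices' objects (`rfl` bridges) -/

section Merge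

variable (c' : ℝ) (D : ℕ)

/-- MERGE `g̃₃`: the typed file's `tg3` is L4-t1's `Typed.Section15A.gtilde3` (§15 u016), definitionally.
[Z22 p.81, tex L4077] [cite: Zhang2022LandauSiegel, §15 p.81] -/
theorem tg3_eq (y : ℝ) : tg3 c' D y = Typed.Section15A.gtilde3 c' D y := rfl

/-- MERGE `g̃₂`: the typed file's `tg2` is L4-t4's `Typed.Section16A.gTilde16` (§16 u009), definitionally.
[Z22 p.89, tex L4441] [cite: Zhang2022LandauSiegel, §16 p.89] -/
theorem tg2_eq (y : ℝ) : tg2 c' D y = Typed.Section16A.gTilde16 c' D y := rfl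

/-- MERGE `ϱ_j`: the typed file's `varrhoB` is L4-t10's `Typed.AppendixB.varrhoJ` (§B.u001), definitionally.
[Z22 p.106, tex L5249] [cite: Zhang2022LandauSiegel, App. B p.106] -/
theorem varrhoB_eq (j n : ℕ) : varrhoB c' D j n = Typed.AppendixB.varrhoJ c' D j n := rfl

end Merge


/-! ## The two `Ψ`-identities for EVERY modulus `D` (appended 2026-08-28)

`step17_u004_holds` / `step17_u014_holds` above carry `[NeZero D]`, which the named facts
`Step17_u004` / `Step17_u014` do not; at `D = 0` one has `𝓛 = log 0 = 0`, `P = e^0 = 1`, so the prime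
window `(⌊P⌋, ⌈P(1+𝓛⁻⁶⁸)⌉) = (1, 1)` is empty, the family `Ψ` (`Chr 0`) is empty, and both statements
(universally quantified over `Ψ`) hold vacuously. D-0026 bookkeeping: no statement, definition or
attribute is edited; no new named fact. -/

section AllModuli

/-- At `D = 0` the family `Ψ` is empty (`P = 1`, window `(1, 1)`). [cite: Zhang2022LandauSiegel, §2 p. 4] -/
theorem Chr.isEmpty_zero : IsEmpty (Chr 0) := by
  refine ⟨fun x => ?_⟩
  have h := x.mem
  simp [primeWindow, bigP, ell] at h

variable (c' : ℝ) {D : ℕ} (χ : DirichletCharacter ℂ D) in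
/-- **§17.u004 for every modulus** — exact-name discharge of `Step17_u004` (`D = 0`: `Ψ` is empty;
`D ≥ 1`: `step17_u004_holds`). [cite: Zhang2022LandauSiegel, §17 u004 p.96] -/
theorem Step17_u004_holds : Step17_u004 c' χ :=
  match D, χ with
  | 0, _ => fun x => (Chr.isEmpty_zero.false x).elim
  | _ + 1, χ => step17_u004_holds c' χ

variable (c' : ℝ) {D : ℕ} (χ : DirichletCharacter ℂ D) in
/-- **§17.u014 for every modulus** — exact-name discharge of `Step17_u014` (`D = 0`: `Ψ` is empty;
`D ≥ 1`: `step17_u014_holds`). [cite: Zhang2022LandauSiegel, §17 u014 p.97] -/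
theorem Step17_u014_holds : Step17_u014 c' χ :=
  match D, χ with
  | 0, _ => fun x => (Chr.isEmpty_zero.false x).elim
  | _ + 1, χ => step17_u014_holds c' χ

end AllModuli

end Literature.NumberTheory.LFunctions.Zhang2022.Typed.Section17
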